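import Literature.AlgebraicTopology.SingularHomology.CupProductExteriorH1
import Literature.AlgebraicTopology.SingularHomology.CircleProductKunneth
import Literature.AlgebraicTopology.SingularHomology.TorusCohomologyRing
import Literature.AlgebraicTopology.SingularHomology.CohomologyOfPoint
import Literature.AlgebraicTopology.SingularHomology.LoopClassesSpan
import Literature.AlgebraicTopology.SingularHomology.RelativeCapProduct
import Literature.AlgebraicTopology.SingularHomology.UniversalCoefficientsField
import Literature.AlgebraicTopology.SingularHomology.ProductKunnethField
import Literature.AlgebraicTopology.SingularHomology.PoincareDualityCorollaries
import Literature.AlgebraicTopology.SingularHomology.FundamentalClassProofs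
import Literature.AlgebraicTopology.SingularHomology.OrientationProofs
import Literature.AlgebraicTopology.SingularHomology.TopologicalGroupOrientation
import Mathlib.LinearAlgebra.ExteriorPower.Basis
import Mathlib.LinearAlgebra.Eigenspace.Triangularizable
import Mathlib.LinearAlgebra.Dual.Lemmas
import Mathlib.Topology.Instances.AddCircle.Defs
import HarnessLib

/-!
# The cohomology ring of a compact group manifold with `b₁ = dim` is the exterior algebra on `H¹`

Let `G` be a compact connected Hausdorff topological group which is a topological `n`-manifold
(charted on `𝔼ⁿ`), and let `F` be an algebraically closed field of characteristic `0` such that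
`dim_F H¹(G; F) ≥ n`.  Then the comparison maps `⋀ᵏ H¹(G; F) → Hᵏ(G; F)`,
`v₁ ∧ ⋯ ∧ v_k ↦ v₁ ⌣ ⋯ ⌣ v_k` (`wedgeToCup`, `CupProductExteriorH1.lean`) are bijective for every
`k` (`HasExteriorCohomologyH1 F G`) and `dim_F H¹(G; F) = n`.  The case of interest is the group
`A(ℂ)` of complex points of an abelian variety `A` of dimension `g` over `ℂ` (`n = 2g`,
`b₁(A(ℂ)) = 2g` by the count of torsion points, `Motives/AbelianVarietyFundamentalGroup`), for
which this is the classical statement `H•(A(ℂ); ℂ) = ⋀• H¹(A(ℂ); ℂ)` (D. Mumford, *Abelian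
Varieties* (1970), §1 (4); H. Lange, Ch. Birkenhake, *Complex Abelian Varieties* (1992),
Lemma 1.1.17, Cor. 1.1.19, Exercise 1.1.6 (7)–(8)), classically read off from `A(ℂ) = ℂ^g/Λ ≈ (S¹)^{2g}`
and the Künneth formula (A. Hatcher, *Algebraic Topology* (2002), Example 3.16).  The tree has no
uniformisation of `A(ℂ)`; the proof given here is H. Hopf's (*Über die Topologie der
Gruppen-Mannigfaltigkeiten und ihre Verallgemeinerungen*, Ann. of Math. 42 (1941), Satz I: the
rational cohomology of a compact connected Lie group is an exterior algebra on odd generators; cf.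
Hatcher 2002, §3.C, Thm. 3C.4 and Prop. 3C.9 for the Hopf-algebra argument) in an elementary form
adapted to the hypothesis `b₁ ≥ n`, using only inputs PROVED in the tree:

* **Injectivity** (`wedgeToCup_injective_of_group`, any path-connected topological group `G` with
  finite-dimensional homology over a field `F ∋ ½`).  For a loop `f : S¹ → G` at `1` the map
  `m_f : G × S¹ → G`, `(x, t) ↦ x · f(t)`, and the Künneth isomorphism
  `Hᵏ⁺¹(G × S¹) = pr₁^* Hᵏ⁺¹(G) ⊕ pr₁^* Hᵏ(G) ⌣ pr₂^* θ` (`CircleProductKunneth.lean`) define the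
  **derivation** `D_f : Hᵏ⁺¹(G) → Hᵏ(G)` by `m_f^* y = pr₁^* y + pr₁^* (D_f y) ⌣ pr₂^* θ`
  (`loopDeriv`; the slant product with the loop).  On `H¹` it is the period `D_f v = ⟨v, f⟩ · 1`
  (`loopCoeff`, with `f^* v = ⟨v, f⟩ θ`), it satisfies the graded Leibniz rule (from
  `m_f^*(v ⌣ y) = m_f^* v ⌣ m_f^* y` and `θ ⌣ θ = 0`), hence the **determinant formula**
  `ε D_{f_k} ⋯ D_{f_1} (v₁ ⌣ ⋯ ⌣ v_k) = ± det ⟨vᵢ, fⱼ⟩` (`iterLoopContr_cupPowOne`, Laplace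
  expansion, exactly as in the tree's `Motives/AbelianVarietyExterior` for Weil cohomologies).
  Since the periods `v ↦ ⟨v, f⟩` span the dual of `H¹(G; F)` (loop classes span `H₁`, Hatcher
  Thm. 2A.1, and `H¹ = H₁^∨` over a field, Thm. 3.2 — the tree's `span_loopClass_eq_top`,
  `kroneckerPairing_injective_of_field`), Mathlib's pairing `⋀ᵏ (H¹)^∨ ⊗ ⋀ᵏ H¹ → F`
  (`exteriorPower.pairingDual`, non-degenerate on the wedge basis) shows `wedgeToCup` injective.
* **Surjectivity** (`range_wedgeToCup_eq_top_of_group`).  Let `ψ = sq^*` for the squaring map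
  `sq(x) = x²` and let `S ⊆ H•(G)` be the subalgebra generated by `H¹` (the image of `wedgeToCup`).
  The spanning half of the Künneth theorem for `G × G` (`ProductKunnethField.lean`, `G` a compact
  manifold) gives `μ^* x = pr₁^* x + pr₂^* x + Σ pr₁^* aᵢ ⌣ pr₂^* bᵢ` with `deg aᵢ, deg bᵢ ≥ 1`, so
  `ψ x - 2x` is decomposable (`sq_sub_two_mem_decomposables`; in particular `ψ = 2` on `H¹`,
  `ψ = 2ᵏ` on `Sᵏ`), and by induction every generalised eigenvalue of `ψ` on `Hᵏ`, `k ≥ 1`, is one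
  of `2, 4, …, 2ᵏ`.  If `S ≠ H•`, take the least degree `d ≥ 2` with `S^d ≠ H^d`; there
  `(ψ - 2)(H^d) ⊆ S^d`, which produces `x ∉ S^d` with `ψ x = 2x`.  Poincaré duality over the field
  `F` (Hatcher Prop. 3.38, the tree's `isPerfPair_cupPairing_of_field_holds`, `G` being
  `ℤ`-orientable as a topological group, `isOrientableOver_int_of_isTopologicalGroup`) gives `y`
  of degree `n - d` with `x ⌣ y ≠ 0`, and splitting `y` into generalised eigenvectors yields a
  non-zero generalised eigenvector of `ψ` in `Hⁿ(G) ≅ F` for an eigenvalue `2 · 2ʲ`, `j ≤ n - 2`.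
  But by injectivity and `b₁ ≥ n` the line `Hⁿ(G)` is spanned by a product of `n` degree-one
  classes, on which `ψ = 2ⁿ` — a contradiction.  (`b₁ ≤ n` follows from injectivity and
  `Hᵏ(G) = 0` for `k > n`.)

## Main statements

* `loopDeriv`, `loopCoeff`, `map_mulLoopMap_eq`, `map_loop_one_eq_smul`, `loopDeriv_cupProduct`,
  `loopContr_cupPowOne`, `iterLoopContr_cupPowOne`, `kroneckerPairing_loopClass`,
  `span_loopCoeff_eq_top`, **`wedgeToCup_injective_of_group`**.
* `decomposables`, `sq_sub_two_mem_decomposables`, `maxGenEigenspace_sq_eq_bot`,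
  **`range_wedgeToCup_eq_top_of_group`**, **`hasExteriorCohomologyH1_of_group`**,
  **`finrank_one_eq_of_group`**.

## References

* [Hopf1941] H. Hopf, Über die Topologie der Gruppen-Mannigfaltigkeiten und ihre
  Verallgemeinerungen, Ann. of Math. (2) 42 (1941), 22–52, Satz I.
* [HatcherAT2002] A. Hatcher, Algebraic Topology, CUP 2002, §3.2 Example 3.16, Thm. 3.15–3.16;
  §3.3 Thm. 3.30, Prop. 3.38; §3.C Thm. 3C.4, Prop. 3C.9; Thm. 2A.1, Thm. 3.2.
* [MumfordAV1970] D. Mumford, Abelian Varieties (1970), §1 (4).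
* [LangeBirkenhake1992] H. Lange, Ch. Birkenhake, Complex Abelian Varieties (1992), Lemma 1.1.17,
  Exercise 1.1.6 (7)–(8).
-/

noncomputable section

open CategoryTheory

universe v

namespace Literature.AlgebraicTopology.SingularHomology

/-! ### Generalities: constant maps, `H⁰` of a path-connected space, the Kronecker pairing on loops -/

section General

variable (R : Type v) [CommRing R] {X Y : Type} [TopologicalSpace X] [TopologicalSpace Y]

/-- A constant map kills cohomology in positive degrees (it factors through a point, whose
positive-degree cohomology vanishes, Hatcher §3.1 p. 199). [cite: HatcherAT2002, §3.1 p. 199] -/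
theorem singularCohomology.map_const_of_ne_zero (y : Y) {k : ℕ} (hk : k ≠ 0)
    (a : singularCohomology R R Y k) :
    singularCohomology.map R R (ContinuousMap.const X y) k a = 0 := by
  have hfac : ContinuousMap.const X y =
      (ContinuousMap.const PUnit.{1} y).comp (ContinuousMap.const X PUnit.unit) := rfl
  rw [hfac, ← singularCohomology.map_map]
  haveI : Subsingleton (singularCohomology R R PUnit.{1} k) := ModuleCat.subsingleton_of_isZero
    (singularCochainComplex.isZero_singularCohomology_of_subsingleton' (R := R) (M := R)
      (X := PUnit.{1}) hk)
  rw [Subsingleton.elim (singularCohomology.map R R (ContinuousMap.const PUnit.{1} y) k a) 0, map_zero]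

/-- `ε(1) = 1` for the identification `ε : H⁰(X; R) ≃ R` of a path-connected space.
[cite: HatcherAT2002, §3.1 p. 199] -/
theorem singularCohomologyZeroEquiv_one [PathConnectedSpace X] :
    singularCohomologyZeroEquiv R R X (singularCohomology.one R X) = 1 := by
  rw [singularCohomology.one, singularCohomologyZeroEquiv_π,
    singularCochainComplex.cocyclesZeroEquiv_apply, singularCochainComplex.iCocycles_mk]
  rfl

/-- **`H⁰(X; R) = R · 1` for `X` path connected**: every class is `ε(a) • 1`.
[cite: HatcherAT2002, §3.1 p. 199] -/
theorem singularCohomology.eq_smul_one [PathConnectedSpace X] (a : singularCohomology R R X 0) :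
    a = (singularCohomologyZeroEquiv R R X a) • singularCohomology.one R X := by
  apply (singularCohomologyZeroEquiv R R X).injective
  rw [map_smul, smul_eq_mul, singularCohomologyZeroEquiv_one, mul_one]

/-- `1 ⌣ b = b` for any proof of `0 + q = q`. [cite: HatcherAT2002, §3.2 p. 211] -/
theorem one_cupProduct' {q : ℕ} (h : 0 + q = q) (b : singularCohomology R R X q) :
    cupProduct h (singularCohomology.one R X) b = b :=
  one_cupProduct b

/-- `a ⌣ 1 = a` for any proof of `p + 0 = p`. [cite: HatcherAT2002, §3.2 p. 211] -/
theorem cupProduct_one' {p : ℕ} (h : p + 0 = p) (a : singularCohomology R R X p) :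
    cupProduct h a (singularCohomology.one R X) = a :=
  cupProduct_one a

/-- **The Kronecker pairing with the Hurewicz class of a loop is evaluation at the loop**:
`⟨a, h(γ)⟩ = a(γ)` (`loopEval` of `LoopTransfer.lean`). [cite: HatcherAT2002, §3.1 p. 198 and Thm. 2A.1] -/
theorem kroneckerPairing_loopClass {x : X} (γ : Path x x) (a : singularCohomology R R X 1) :
    kroneckerPairing R R X 1 a (loopClass R R (1 : R) γ) =
      loopEval (R := R) (M := R) (SingularSimplex.ofPath γ)
        (by rw [SingularSimplex.ofPath_face_zero, SingularSimplex.ofPath_face_one]) a := by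
  induction a using singularCohomology_induction_on with
  | h φ =>
    have hz : (singularChainComplex R R X).d 1 0
        (singularChainComplex.single (R := R) (SingularSimplex.ofPath γ) (1 : R)) = 0 := by
      have h := d_single_ofPath_loop R R (1 : R) γ
      rwa [show (ComplexShape.down ℕ).next 1 = 0 from ChainComplex.next_nat_succ 0] at h
    rw [loopClass, homologyCls_eq_homologyπ_cyclesMk _ _ 0 (ChainComplex.next_nat_succ 0) hz,
      loopEval_π]
    rw [kroneckerPairing_π_single {(0 : Fin 1)} (fun _ => SingularSimplex.ofPath γ) (fun _ => (1 : R)) φ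
      _ (by rw [Finset.sum_singleton]; exact (singularChainComplex R R X).i_cyclesMk _ _ _ _)]
    rw [Finset.sum_singleton, smul_eq_mul, mul_one]

end General

/-! ### Loops and the maps `m_f : G × S¹ → G`, `(x, t) ↦ x · f(t)` -/

section Loops

variable {G : Type} [TopologicalSpace G] [Group G]

section Mul

variable [IsTopologicalGroup G]

/-- `m_f : G × S¹ → G`, `(x, t) ↦ x · f(t)`, for a continuous `f : S¹ → G` (`S¹ = ℝ/ℤ`).
[cite: HatcherAT2002, §3.C Lemma 3C.3] -/
def mulLoopMap (f : C(UnitAddCircle, G)) : C(G × UnitAddCircle, G) where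
  toFun p := p.1 * f p.2
  continuous_toFun := continuous_fst.mul (f.continuous.comp continuous_snd)

/-- `m_f (x, t) = x · f(t)`. [folklore] -/
@[simp]
theorem mulLoopMap_apply (f : C(UnitAddCircle, G)) (p : G × UnitAddCircle) :
    mulLoopMap f p = p.1 * f p.2 := rfl

/-- `m_f ∘ (x ↦ (x, 0)) = 𝟙` for a loop based at `1` (`f 0 = 1`). [folklore] -/
theorem mulLoopMap_comp_circleSlice (f : C(UnitAddCircle, G)) (hf : f 0 = 1) :
    (mulLoopMap f).comp circleSlice = ContinuousMap.id G := by
  ext x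
  change x * f 0 = x
  rw [hf, mul_one]

end Mul

/-- The slice `t ↦ (1, t)` of `G × S¹`. [folklore] -/
def unitSlice : C(UnitAddCircle, G × UnitAddCircle) :=
  (ContinuousMap.const UnitAddCircle (1 : G)).prodMk (ContinuousMap.id UnitAddCircle)

/-- `pr₁ ∘ (t ↦ (1, t))` is constant. [folklore] -/
theorem fst_comp_unitSlice :
    ContinuousMap.fst.comp (unitSlice (G := G)) = ContinuousMap.const UnitAddCircle (1 : G) := by
  ext t; rfl

/-- `pr₂ ∘ (t ↦ (1, t)) = 𝟙`. [folklore] -/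
theorem snd_comp_unitSlice :
    ContinuousMap.snd.comp (unitSlice (G := G)) = ContinuousMap.id UnitAddCircle := by
  ext t; rfl

/-- `m_f ∘ (t ↦ (1, t)) = f`. [folklore] -/
theorem mulLoopMap_comp_unitSlice [IsTopologicalGroup G] (f : C(UnitAddCircle, G)) :
    (mulLoopMap f).comp unitSlice = f := by
  ext t
  change 1 * f t = f t
  rw [one_mul]

/-- The circle map `S¹ = ℝ/ℤ → G` of a loop `γ : [0, 1] → G` at `1` (descending `γ` along
`[0, 1] → ℝ/ℤ`; Mathlib's `AddCircle.liftIco`). [cite: HatcherAT2002, Thm. 1.7] -/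
def loopCircleMap (γ : Path (1 : G) 1) : C(UnitAddCircle, G) where
  toFun := AddCircle.liftIco 1 0 γ.extend
  continuous_toFun := by
    refine AddCircle.liftIco_zero_continuous ?_ γ.continuous_extend.continuousOn
    rw [γ.extend_zero, γ.extend_one]

/-- The circle map of `γ` at `t mod 1` is `γ(t)` for `t ∈ [0, 1)`. [folklore] -/
theorem loopCircleMap_coe (γ : Path (1 : G) 1) {t : ℝ} (ht : t ∈ Set.Ico (0 : ℝ) 1) :
    loopCircleMap γ (t : UnitAddCircle) = γ.extend t := by
  change AddCircle.liftIco 1 0 γ.extend (t : UnitAddCircle) = γ.extend t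
  exact AddCircle.liftIco_zero_coe_apply ht

/-- The circle map of a loop at `1` is based at `1`. [folklore] -/
theorem loopCircleMap_zero (γ : Path (1 : G) 1) : loopCircleMap γ 0 = 1 := by
  have h := loopCircleMap_coe γ (t := 0) ⟨le_rfl, one_pos⟩
  rw [γ.extend_zero] at h
  rwa [show ((0 : ℝ) : UnitAddCircle) = 0 from rfl] at h

/-- Composing the fundamental loop `t ↦ t mod 1` of `ℝ/ℤ` with the circle map of `γ` gives back
`γ`. [cite: HatcherAT2002, Thm. 1.7] -/
theorem addCircleLoop_map_loopCircleMap (γ : Path (1 : G) 1) :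
    (Literature.AlgebraicTopology.FundamentalGroup.addCircleLoop (1 : ℝ) 0).map
      (loopCircleMap γ).continuous = γ.cast (loopCircleMap_zero γ) (loopCircleMap_zero γ) := by
  ext t
  change loopCircleMap γ (0 + (((t : ℝ) * 1 : ℝ) : UnitAddCircle)) = γ t
  rw [zero_add, mul_one]
  rcases lt_or_eq_of_le t.2.2 with ht | ht
  · rw [loopCircleMap_coe γ ⟨t.2.1, ht⟩, Path.extend_extends']
  · have ht1 : t = 1 := Subtype.ext ht
    subst ht1
    change loopCircleMap γ ((1 : ℝ) : UnitAddCircle) = γ 1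
    rw [AddCircle.coe_period, loopCircleMap_zero, γ.target]

end Loops

/-! ### The derivation `D_f : Hᵏ⁺¹(G) → Hᵏ(G)` of a loop -/

section Deriv

variable (F : Type v) [Field F] {G : Type} [TopologicalSpace G] [Group G] [IsTopologicalGroup G]
  (hG : ∀ k, Module.Finite F (singularHomology F F G k))

/-- The class `pr₂^* θ ∈ H¹(G × S¹; F)` of the circle factor (local notation `prθ`). -/
local notation "prθ" =>
  (singularCohomology.map F F (ContinuousMap.snd : C(G × UnitAddCircle, UnitAddCircle)) 1 (circleClass F))

/-- The pull-back `pr₁^*` to `G × S¹` in degree `k` (local notation `prG k`). -/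
local notation "prG" =>
  (fun k => singularCohomology.map F F (ContinuousMap.fst : C(G × UnitAddCircle, G)) k)

omit [Group G] [IsTopologicalGroup G] in
/-- `pr₂^* θ ⌣ pr₂^* θ = 0` (`θ ⌣ θ = 0` in `H²(S¹)`). [cite: HatcherAT2002, §3.2 Example 3.16] -/
theorem cupProduct_sndTheta_sndTheta (h : 1 + 1 = 2) : cupProduct h prθ prθ = 0 := by
  rw [← cupProduct_map]
  haveI := subsingleton_singularCohomology_unitAddCircle_two F
  rw [Subsingleton.elim (cupProduct h (circleClass F) (circleClass F)) 0, map_zero]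

/-- **The derivation `D_f : Hᵏ⁺¹(G; F) → Hᵏ(G; F)` of a loop `f : S¹ → G`**: the second Künneth
component of `m_f^*`, i.e. `m_f^* y = pr₁^* a + pr₁^* (D_f y) ⌣ pr₂^* θ` (the slant product of
`m_f^* y` with the fundamental class of `S¹`; Hatcher §3.B p. 280 / §3.C p. 283, the reduced
coproduct of an H-space). [cite: HatcherAT2002, §3.C Lemma 3C.3 and p. 283] -/
def loopDeriv (f : C(UnitAddCircle, G)) (k : ℕ) :
    singularCohomology F F G (k + 1) →ₗ[F] singularCohomology F F G k :=
  LinearMap.snd F _ _ ∘ₗ (kunnethCircle F hG k).symm.toLinearMap ∘ₗ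
    (singularCohomology.map F F (mulLoopMap f) (k + 1)).hom

/-- Uniqueness of the Künneth decomposition: if `m_f^* y = pr₁^* a + pr₁^* b ⌣ pr₂^* θ` then
`D_f y = b`. [cite: HatcherAT2002, §3.2 Thm. 3.15] -/
theorem loopDeriv_eq_of_map_eq (f : C(UnitAddCircle, G)) (k : ℕ) {y a : singularCohomology F F G (k + 1)}
    {b : singularCohomology F F G k}
    (h : singularCohomology.map F F (mulLoopMap f) (k + 1) y = kunnethCircleMap F k (a, b)) :
    loopDeriv F hG f k y = b := by
  change LinearMap.snd F _ _ ((kunnethCircle F hG k).symm (singularCohomology.map F F (mulLoopMap f) (k + 1) y)) = b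
  rw [h, ← kunnethCircle_apply F hG, LinearEquiv.symm_apply_apply]
  rfl

/-- **`m_f^* y = pr₁^* y + pr₁^* (D_f y) ⌣ pr₂^* θ`** for a loop `f` based at `1`: the first Künneth
component is recovered by the slice `x ↦ (x, 0)`, along which `m_f` restricts to the identity.
[cite: HatcherAT2002, §3.2 Thm. 3.15] -/
theorem map_mulLoopMap_eq (f : C(UnitAddCircle, G)) (hf : f 0 = 1) (k : ℕ)
    (y : singularCohomology F F G (k + 1)) :
    singularCohomology.map F F (mulLoopMap f) (k + 1) y = kunnethCircleMap F k (y, loopDeriv F hG f k y) := by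
  obtain ⟨⟨a, b⟩, hab⟩ := (kunnethCircle F hG k).surjective (singularCohomology.map F F (mulLoopMap f) (k + 1) y)
  rw [kunnethCircle_apply] at hab
  have hb : loopDeriv F hG f k y = b := loopDeriv_eq_of_map_eq F hG f k hab.symm
  have ha : a = y := by
    have h := congrArg (singularCohomology.map F F circleSlice (k + 1)) hab
    rw [map_circleSlice_kunnethCircleMap, singularCohomology.map_map,
      mulLoopMap_comp_circleSlice f hf, singularCohomology.map_id] at h
    exact h
  rw [← hab, ha, hb]

variable [PathConnectedSpace G]

/-- **The period `⟨v, f⟩ ∈ F` of a degree-one class on a loop**: `D_f v = ⟨v, f⟩ · 1` in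
`H⁰(G; F) = F · 1`. [cite: HatcherAT2002, §3.1 p. 198] -/
def loopCoeff (f : C(UnitAddCircle, G)) : singularCohomology F F G 1 →ₗ[F] F :=
  (singularCohomologyZeroEquiv F F G).toLinearMap ∘ₗ loopDeriv F hG f 0

/-- `D_f v = ⟨v, f⟩ • 1` for `v ∈ H¹(G; F)`. [cite: HatcherAT2002, §3.1 p. 198] -/
theorem loopDeriv_zero_eq_smul_one (f : C(UnitAddCircle, G)) (v : singularCohomology F F G 1) :
    loopDeriv F hG f 0 v = loopCoeff F hG f v • singularCohomology.one F G :=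
  singularCohomology.eq_smul_one F (loopDeriv F hG f 0 v)

/-- **Primitivity in degree one**: `m_f^* v = pr₁^* v + ⟨v, f⟩ pr₂^* θ` for `v ∈ H¹(G; F)` and a
loop `f` at `1`. [cite: HatcherAT2002, §3.C Lemma 3C.3] -/
theorem map_mulLoopMap_one (f : C(UnitAddCircle, G)) (hf : f 0 = 1) (v : singularCohomology F F G 1) :
    singularCohomology.map F F (mulLoopMap f) 1 v = prG 1 v + loopCoeff F hG f v • prθ := by
  rw [map_mulLoopMap_eq F hG f hf 0 v, kunnethCircleMap_apply, loopDeriv_zero_eq_smul_one, map_smul,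
    LinearMap.map_smul₂, singularCohomology.map_one, one_cupProduct']

/-- **`f^* v = ⟨v, f⟩ θ` in `H¹(S¹; F)`** for `v ∈ H¹(G; F)` and a loop `f : S¹ → G` at `1`
(restrict the primitivity formula to `{1} × S¹`). [cite: HatcherAT2002, §3.1 p. 198] -/
theorem map_loop_one_eq_smul (f : C(UnitAddCircle, G)) (hf : f 0 = 1) (v : singularCohomology F F G 1) :
    singularCohomology.map F F f 1 v = loopCoeff F hG f v • circleClass F := by
  have h := congrArg (singularCohomology.map F F (unitSlice (G := G)) 1) (map_mulLoopMap_one F hG f hf v)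
  rw [singularCohomology.map_map, mulLoopMap_comp_unitSlice, map_add, map_smul,
    singularCohomology.map_map, singularCohomology.map_map, fst_comp_unitSlice, snd_comp_unitSlice,
    singularCohomology.map_id, singularCohomology.map_const_of_ne_zero F (1 : G) one_ne_zero, zero_add] at h
  exact h

/-- `⟨θ, loop⟩ = 1` for the fundamental loop of `ℝ/ℤ`. [cite: HatcherAT2002, Thm. 1.7] -/
theorem loopEval_circleLoopSimplex_circleClass :
    loopEval (R := F) (M := F) circleLoopSimplex circleLoopSimplex_face (circleClass F) = 1 := by
  rw [circleClass, loopEval_π, iCocycles_circleCocycle, circleCochain_circleLoopSimplex]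

/-- The period is the evaluation of `f^* v` on the fundamental loop: `⟨f^* v, loop⟩ = ⟨v, f⟩`.
[cite: HatcherAT2002, §3.1 p. 198] -/
theorem loopEval_map_loop (f : C(UnitAddCircle, G)) (hf : f 0 = 1) (v : singularCohomology F F G 1) :
    loopEval (R := F) (M := F) circleLoopSimplex circleLoopSimplex_face (singularCohomology.map F F f 1 v) =
      loopCoeff F hG f v := by
  rw [map_loop_one_eq_smul F hG f hf, map_smul, loopEval_circleLoopSimplex_circleClass, smul_eq_mul, mul_one]

/-- **The period of the circle map of a loop `γ` at `1` is the Kronecker pairing with its Hurewicz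
class**: `⟨v, γ̂⟩ = ⟨v, h(γ)⟩`. [cite: HatcherAT2002, §3.1 p. 198 and Thm. 2A.1] -/
theorem loopCoeff_loopCircleMap (γ : Path (1 : G) 1) (v : singularCohomology F F G 1) :
    loopCoeff F hG (loopCircleMap γ) v = kroneckerPairing F F G 1 v (loopClass F F (1 : F) γ) := by
  rw [← loopEval_map_loop F hG (loopCircleMap γ) (loopCircleMap_zero γ), loopEval_map,
    kroneckerPairing_loopClass]
  have e : circleLoopSimplex.map (loopCircleMap γ) =
      SingularSimplex.ofPath (γ.cast (loopCircleMap_zero γ) (loopCircleMap_zero γ)) := by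
    rw [circleLoopSimplex, SingularSimplex.ofPath_map, addCircleLoop_map_loopCircleMap]
  have e' : SingularSimplex.ofPath (γ.cast (loopCircleMap_zero γ) (loopCircleMap_zero γ)) =
      SingularSimplex.ofPath γ := by
    apply SingularSimplex.toContinuousMap_injective
    ext s
    rw [SingularSimplex.ofPath_apply, SingularSimplex.ofPath_apply]
    rfl
  have key : ∀ (σ τ : SingularSimplex G 1) (hσ : σ.face 0 = σ.face 1) (hτ : τ.face 0 = τ.face 1), σ = τ →
      loopEval (R := F) (M := F) σ hσ v = loopEval (R := F) (M := F) τ hτ v := by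
    rintro σ τ hσ hτ rfl; rfl
  exact key _ _ _ _ (e.trans e')

/-! ### The Leibniz rule -/

omit [Group G] [IsTopologicalGroup G] [PathConnectedSpace G] in
/-- `pr₁^* v ⌣ (pr₁^* b ⌣ pr₂^* θ) = pr₁^* (v ⌣ b) ⌣ pr₂^* θ`. [cite: HatcherAT2002, §3.2 Prop. 3.10] -/
theorem cupProduct_fst_fst_sndTheta {k : ℕ} (v : singularCohomology F F G 1) (b : singularCohomology F F G k)
    (h : 1 + (k + 1) = k + 1 + 1) :
    cupProduct h (prG 1 v) (cupProduct (rfl : k + 1 = k + 1) (prG k b) prθ) =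
      cupProduct (rfl : k + 1 + 1 = k + 1 + 1) (prG (k + 1) (cupProduct (Nat.add_comm 1 k) v b)) prθ := by
  rw [← cupProduct_assoc (Nat.add_comm 1 k) rfl rfl h, cupProduct_map]

omit [Group G] [IsTopologicalGroup G] [PathConnectedSpace G] in
/-- `pr₂^* θ ⌣ (pr₁^* b ⌣ pr₂^* θ) = 0`. [cite: HatcherAT2002, §3.2 Example 3.16] -/
theorem cupProduct_sndTheta_fst_sndTheta {k : ℕ} (b : singularCohomology F F G k) (h : 1 + (k + 1) = k + 1 + 1) :
    cupProduct h prθ (cupProduct (rfl : k + 1 = k + 1) (prG k b) prθ) = 0 := by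
  rw [cupProduct_gradedComm_holds F (G × UnitAddCircle) (rfl : k + 1 = k + 1) (Nat.add_comm 1 k), LinearMap.map_smul,
    ← cupProduct_assoc (rfl : 1 + 1 = 2) (Nat.add_comm 1 k) (by omega) h, cupProduct_sndTheta_sndTheta,
    LinearMap.map_zero₂, smul_zero]

omit [Group G] [IsTopologicalGroup G] [PathConnectedSpace G] in
/-- Bilinear expansion of `(A + c B) ⌣ (C + D)`. [folklore] -/
theorem cupProduct_add_smul_add {p q n : ℕ} (h : p + q = n) (c : F)
    (A B : singularCohomology F F (G × UnitAddCircle) p) (C D : singularCohomology F F (G × UnitAddCircle) q) :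
    cupProduct h (A + c • B) (C + D) =
      cupProduct h A C + cupProduct h A D + c • cupProduct h B C + c • cupProduct h B D := by
  simp only [map_add, map_smul, LinearMap.add_apply, LinearMap.smul_apply]
  abel

/-- **Leibniz rule**: `D_f (v ⌣ y) = (-1)ᵏ⁺¹ ⟨v, f⟩ y + v ⌣ D_f y` for `v ∈ H¹(G)`, `y ∈ Hᵏ⁺¹(G)`
(expand `m_f^*(v ⌣ y) = (pr₁^* v + ⟨v, f⟩ pr₂^* θ) ⌣ (pr₁^* y + pr₁^* D_f y ⌣ pr₂^* θ)` with
`θ ⌣ θ = 0` and compare Künneth components). [cite: HatcherAT2002, §3.C p. 283–284] -/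
theorem loopDeriv_cupProduct (f : C(UnitAddCircle, G)) (hf : f 0 = 1) (k : ℕ)
    (v : singularCohomology F F G 1) (y : singularCohomology F F G (k + 1)) :
    loopDeriv F hG f (k + 1) (cupProduct (Nat.add_comm 1 (k + 1)) v y) =
      ((-1 : F) ^ (k + 1) * loopCoeff F hG f v) • y + cupProduct (Nat.add_comm 1 k) v (loopDeriv F hG f k y) := by
  apply loopDeriv_eq_of_map_eq F hG f (k + 1) (a := cupProduct (Nat.add_comm 1 (k + 1)) v y)
  have e2 := map_mulLoopMap_eq F hG f hf k y
  rw [kunnethCircleMap_apply] at e2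
  rw [cupProduct_map, map_mulLoopMap_one F hG f hf v, e2, kunnethCircleMap_apply, cupProduct_add_smul_add,
    ← cupProduct_map, cupProduct_fst_fst_sndTheta, cupProduct_sndTheta_fst_sndTheta, smul_zero, add_zero,
    cupProduct_gradedComm_holds F (G × UnitAddCircle) (Nat.add_comm 1 (k + 1)) rfl prθ]
  simp only [map_add, map_smul, LinearMap.add_apply, LinearMap.smul_apply, smul_smul, one_mul]
  rw [mul_comm (loopCoeff F hG f v)]
  abel

/-- `D_f (v ⌣ y) = ⟨v, f⟩ y` for `v ∈ H¹(G)`, `y ∈ H⁰(G) = F · 1`. [cite: HatcherAT2002, §3.C p. 283–284] -/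
theorem loopDeriv_cupProduct_zero (f : C(UnitAddCircle, G)) (v : singularCohomology F F G 1)
    (y : singularCohomology F F G 0) :
    loopDeriv F hG f 0 (cupProduct (Nat.add_comm 1 0) v y) = loopCoeff F hG f v • y := by
  rw [singularCohomology.eq_smul_one F y, LinearMap.map_smul, cupProduct_one', LinearMap.map_smul,
    loopDeriv_zero_eq_smul_one, smul_smul, smul_smul, mul_comm]

end Deriv

/-! ### The normalised contraction, the Leibniz rule on iterated products, the determinant formula -/

section Contraction

variable (F : Type v) [Field F] {G : Type} [TopologicalSpace G] [Group G] [IsTopologicalGroup G]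
  (hG : ∀ k, Module.Finite F (singularHomology F F G k)) [PathConnectedSpace G]

/-- The **normalised contraction** `C_f = (-1)ᵏ D_f : Hᵏ⁺¹(G) → Hᵏ(G)` of a loop `f`, for which
the Leibniz rule takes the form `C_f(v ⌣ y) = ⟨v, f⟩ y - v ⌣ C_f y`. [folklore] -/
def loopContr (f : C(UnitAddCircle, G)) (k : ℕ) :
    singularCohomology F F G (k + 1) →ₗ[F] singularCohomology F F G k :=
  ((-1 : F) ^ k) • loopDeriv F hG f k

omit [PathConnectedSpace G] in
/-- `C_f y = (-1)ᵏ D_f y`. [folklore] -/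
theorem loopContr_apply (f : C(UnitAddCircle, G)) (k : ℕ) (y : singularCohomology F F G (k + 1)) :
    loopContr F hG f k y = ((-1 : F) ^ k) • loopDeriv F hG f k y := rfl

/-- **Leibniz rule for the normalised contraction**: `C_f(v ⌣ y) = ⟨v, f⟩ y - v ⌣ C_f y`
(`v ∈ H¹(G)`, `y ∈ Hᵏ⁺¹(G)`). [cite: HatcherAT2002, §3.C p. 283–284] -/
theorem loopContr_cupProduct (f : C(UnitAddCircle, G)) (hf : f 0 = 1) (k : ℕ)
    (v : singularCohomology F F G 1) (y : singularCohomology F F G (k + 1)) :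
    loopContr F hG f (k + 1) (cupProduct (Nat.add_comm 1 (k + 1)) v y) =
      loopCoeff F hG f v • y - cupProduct (Nat.add_comm 1 k) v (loopContr F hG f k y) := by
  simp only [loopContr_apply]
  rw [loopDeriv_cupProduct F hG f hf k v y, LinearMap.map_smul, smul_add, smul_smul, ← mul_assoc, ← mul_pow,
    neg_one_mul, neg_neg, one_pow, one_mul, pow_succ, mul_neg_one, neg_smul, sub_eq_add_neg]

/-- `C_f(v ⌣ y) = ⟨v, f⟩ y` for `y ∈ H⁰(G)`. [cite: HatcherAT2002, §3.C p. 283–284] -/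
theorem loopContr_cupProduct_zero (f : C(UnitAddCircle, G)) (v : singularCohomology F F G 1)
    (y : singularCohomology F F G 0) :
    loopContr F hG f 0 (cupProduct (Nat.add_comm 1 0) v y) = loopCoeff F hG f v • y := by
  rw [loopContr_apply, pow_zero, one_smul, loopDeriv_cupProduct_zero]

/-- **Leibniz rule on an iterated product of degree-one classes**:
`C_f(v₀ ⌣ ⋯ ⌣ v_d) = Σ_p (-1)ᵖ ⟨v_p, f⟩ v₀ ⌣ ⋯ v̂_p ⋯ ⌣ v_d` (as the tree's
`Motives.WeilCohomology.contrOne_prodMap`). [cite: HatcherAT2002, §3.C p. 283–284] -/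
theorem loopContr_cupPowOne (f : C(UnitAddCircle, G)) (hf : f 0 = 1) (d : ℕ)
    (v : Fin (d + 1) → singularCohomology F F G 1) :
    loopContr F hG f d (cupPowOne F G (d + 1) v) =
      ∑ p : Fin (d + 1), ((-1 : F) ^ (p : ℕ) * loopCoeff F hG f (v p)) •
        cupPowOne F G d (fun i => v (p.succAbove i)) := by
  induction d with
  | zero =>
    rw [cupPowOne_succ, cupPowOne_zero, Fin.sum_univ_one, loopContr_cupProduct_zero, cupPowOne_zero]
    simp
  | succ d ih =>
    rw [cupPowOne_succ, loopContr_cupProduct F hG f hf d, ih]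
    conv_rhs => rw [Fin.sum_univ_succ]
    simp only [Fin.val_zero, pow_zero, one_mul, Fin.zero_succAbove, Fin.val_succ, map_sum,
      LinearMap.map_smul, sub_eq_add_neg, ← Finset.sum_neg_distrib]
    congr 1
    refine Finset.sum_congr rfl fun q _ ↦ ?_
    rw [cupPowOne_succ]
    simp only [Fin.succ_succAbove_zero, Fin.tail, ← neg_smul, pow_succ]
    congr 1
    · ring
    · congr 2
      funext i
      exact congrArg v (Fin.succ_succAbove_succ q i).symm

/-- The **iterated contraction** `ε ∘ C_{f_{d-1}} ∘ ⋯ ∘ C_{f₀} : Hᵈ(G) → F` against `d` loops.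
[folklore] -/
def iterLoopContr : (d : ℕ) → (Fin d → C(UnitAddCircle, G)) → (singularCohomology F F G d →ₗ[F] F)
  | 0, _ => (singularCohomologyZeroEquiv F F G).toLinearMap
  | d + 1, f => iterLoopContr d (Fin.tail f) ∘ₗ loopContr F hG (f 0) d

/-- **Determinant formula**: `ε C_{f_{d-1}} ⋯ C_{f₀} (v₀ ⌣ ⋯ ⌣ v_{d-1}) = det (⟨v_j, f_i⟩)ᵢⱼ`
(Laplace expansion along the first row matches the Leibniz rule). [cite: HatcherAT2002, §3.C p. 283–284] -/
theorem iterLoopContr_cupPowOne (d : ℕ) (f : Fin d → C(UnitAddCircle, G)) (hf : ∀ i, f i 0 = 1)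
    (v : Fin d → singularCohomology F F G 1) :
    iterLoopContr F hG d f (cupPowOne F G d v) = (Matrix.of fun i j => loopCoeff F hG (f i) (v j)).det := by
  induction d with
  | zero =>
    rw [Matrix.det_isEmpty, iterLoopContr, cupPowOne_zero]
    exact singularCohomologyZeroEquiv_one F
  | succ d ih =>
    rw [iterLoopContr, LinearMap.comp_apply, loopContr_cupPowOne F hG (f 0) (hf 0), map_sum,
      Matrix.det_succ_row_zero]
    refine Finset.sum_congr rfl fun p _ ↦ ?_
    rw [LinearMap.map_smul, ih (Fin.tail f) (fun i => hf _), smul_eq_mul]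
    rfl

/-! ### The periods span the dual of `H¹`; injectivity of `⋀ᵈ H¹ → Hᵈ` -/

/-- **The periods `v ↦ ⟨v, f⟩` of the loops at `1` span the dual of `H¹(G; F)`**: a class with all
periods zero pairs to zero with every Hurewicz class (`loopCoeff_loopCircleMap`), and loop classes
span `H₁(G)` (Hatcher Thm. 2A.1) while `H¹ → H₁^∨` is injective over a field (Thm. 3.2).
[cite: HatcherAT2002, Thm. 2A.1 and Thm. 3.2] -/
theorem span_loopCoeff_eq_top :
    Submodule.span F (Set.range fun f : {f : C(UnitAddCircle, G) // f 0 = 1} => loopCoeff F hG f.1) = ⊤ := by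
  haveI := fun k => hG k
  haveI : FiniteDimensional F (singularCohomology F F G 1) :=
    finite_singularCohomology_of_finite_singularHomology 1 (fun m _ => hG m)
  set W := Submodule.span F (Set.range fun f : {f : C(UnitAddCircle, G) // f 0 = 1} => loopCoeff F hG f.1)
  have hW : W.dualCoannihilator = ⊥ := by
    rw [Submodule.eq_bot_iff]
    intro v hv
    rw [Submodule.mem_dualCoannihilator] at hv
    apply kroneckerPairing_injective_of_field F G 1
    rw [map_zero]
    refine singularHomology.linearMap_ext_loopClass (R := F) (1 : G) fun γ => ?_
    rw [LinearMap.zero_apply, ← loopCoeff_loopCircleMap F hG γ v]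
    exact hv _ (Submodule.subset_span ⟨⟨loopCircleMap γ, loopCircleMap_zero γ⟩, rfl⟩)
  rw [← Subspace.dualCoannihilator_dualAnnihilator_eq (W := W), hW, Submodule.dualAnnihilator_bot]

/-- **The iterated contraction against loops computes Mathlib's exterior pairing**: for loops
`f₀, …, f_{d-1}` at `1` with periods `φᵢ = ⟨-, fᵢ⟩`,
`ε C_{f_{d-1}} ⋯ C_{f₀} ∘ wedgeToCup = pairingDual (φ₀ ∧ ⋯ ∧ φ_{d-1})` on `⋀ᵈ H¹(G; F)`.
[folklore] -/
theorem iterLoopContr_comp_wedgeToCup [Invertible (2 : F)] (d : ℕ) (f : Fin d → C(UnitAddCircle, G))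
    (hf : ∀ i, f i 0 = 1) :
    iterLoopContr F hG d f ∘ₗ wedgeToCup F G d =
      exteriorPower.pairingDual F (singularCohomology F F G 1) d
        (exteriorPower.ιMulti F d fun i => loopCoeff F hG (f i)) := by
  refine exteriorPower.linearMap_ext ?_
  ext v
  simp only [LinearMap.compAlternatingMap_apply, LinearMap.coe_comp, Function.comp_apply, wedgeToCup_ιMulti,
    exteriorPower.pairingDual_ιMulti_ιMulti]
  rw [iterLoopContr_cupPowOne F hG d f hf v, ← Matrix.det_transpose]
  rfl

/-- **Injectivity of the comparison map `⋀ᵈ H¹(G; F) → Hᵈ(G; F)`** for a path-connected topological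
group `G` with finite-dimensional homology over a field `F ∋ ½` (Hopf 1941, Satz I; Hatcher
Prop. 3C.9 / Thm. 3C.4 for the exterior algebra inside `H•` of an H-space): a wedge `ω` with
`wedgeToCup ω = 0` pairs to zero with all `φ₀ ∧ ⋯ ∧ φ_{d-1}`, `φᵢ` periods of loops
(`iterLoopContr_comp_wedgeToCup`), hence with all of `⋀ᵈ (H¹)^∨` (`span_loopCoeff_eq_top`), so
all its coordinates in a wedge basis vanish. [cite: Hopf1941, Satz I] [cite: HatcherAT2002, §3.C Thm. 3C.4] -/
theorem wedgeToCup_injective_of_group (hG : ∀ k, Module.Finite F (singularHomology F F G k)) [Invertible (2 : F)] (d : ℕ) :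
    Function.Injective (wedgeToCup F G d) := by
  classical
  haveI := fun k => hG k
  haveI : FiniteDimensional F (singularCohomology F F G 1) :=
    finite_singularCohomology_of_finite_singularHomology 1 (fun m _ => hG m)
  rw [injective_iff_map_eq_zero]
  intro ω hω
  -- every `η ∈ ⋀ᵈ (H¹)^∨` pairs to zero with `ω`
  have hpair : ∀ η : ⋀[F]^d (Module.Dual F (singularCohomology F F G 1)),
      exteriorPower.pairingDual F (singularCohomology F F G 1) d η ω = 0 := by
    let L := {f : C(UnitAddCircle, G) // f 0 = 1}
    letI : LinearOrder L := linearOrderOfSTO WellOrderingRel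
    have hspan := exteriorPower.ιMulti_family_span_of_span F (n := d) (span_loopCoeff_eq_top F hG)
    intro η
    have hη : η ∈ Submodule.span F (Set.range (exteriorPower.ιMulti_family F d fun f : L => loopCoeff F hG f.1)) := by
      rw [hspan]; exact Submodule.mem_top
    refine Submodule.span_induction (p := fun η _ => exteriorPower.pairingDual F (singularCohomology F F G 1) d η ω = 0)
      ?_ ?_ ?_ ?_ hη
    · rintro _ ⟨s, rfl⟩
      rw [exteriorPower.ιMulti_family]
      have h := LinearMap.congr_fun (iterLoopContr_comp_wedgeToCup F hG d
        (fun i => (Set.powersetCard.ofFinEmbEquiv.symm s i).1)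
        (fun i => (Set.powersetCard.ofFinEmbEquiv.symm s i).2)) ω
      rw [LinearMap.comp_apply, hω, map_zero] at h
      exact h.symm
    · rw [map_zero, LinearMap.zero_apply]
    · intro x y _ _ hx hy
      rw [map_add, LinearMap.add_apply, hx, hy, add_zero]
    · intro c x _ hx
      rw [map_smul, LinearMap.smul_apply, hx, smul_zero]
  -- hence all coordinates of `ω` in a wedge basis vanish
  let b := Module.finBasis F (singularCohomology F F G 1)
  apply (b.exteriorPower d).repr.injective
  rw [map_zero]
  ext s
  rw [exteriorPower.basis_repr_apply, Finsupp.zero_apply]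
  exact hpair _

end Contraction

/-! ### The squaring map `ψ = sq^*` and decomposable classes -/

section Squaring

/-! From here on the coefficient field lives in `Type`, as required by the tree's Künneth theorem
for products of manifolds (`ProductKunnethField.lean`). -/

variable (F : Type) [Field F] {G : Type} [TopologicalSpace G] [Group G] [IsTopologicalGroup G]

/-- The group law `μ : G × G → G` as a continuous map. [folklore] -/
def mulMap : C(G × G, G) where
  toFun p := p.1 * p.2
  continuous_toFun := continuous_fst.mul continuous_snd

/-- The squaring map `sq : G → G`, `x ↦ x · x`. [cite: HatcherAT2002, §3.C p. 283] -/
def sqMap : C(G, G) where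
  toFun x := x * x
  continuous_toFun := continuous_id.mul continuous_id

/-- The slice `x ↦ (x, 1)`. [folklore] -/
def sliceLeft : C(G, G × G) := (ContinuousMap.id G).prodMk (ContinuousMap.const G (1 : G))

/-- The slice `x ↦ (1, x)`. [folklore] -/
def sliceRight : C(G, G × G) := (ContinuousMap.const G (1 : G)).prodMk (ContinuousMap.id G)

/-- The diagonal `x ↦ (x, x)`. [folklore] -/
def diagMap : C(G, G × G) := (ContinuousMap.id G).prodMk (ContinuousMap.id G)

omit [IsTopologicalGroup G] in
/-- `pr₁ ∘ (x ↦ (x, 1)) = 𝟙`. [folklore] -/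
theorem fst_comp_sliceLeft : ContinuousMap.fst.comp (sliceLeft (G := G)) = ContinuousMap.id G := by ext; rfl
omit [IsTopologicalGroup G] in
/-- `pr₂ ∘ (x ↦ (x, 1))` is constant. [folklore] -/
theorem snd_comp_sliceLeft : ContinuousMap.snd.comp (sliceLeft (G := G)) = ContinuousMap.const G (1 : G) := by ext; rfl
omit [IsTopologicalGroup G] in
/-- `pr₁ ∘ (x ↦ (1, x))` is constant. [folklore] -/
theorem fst_comp_sliceRight : ContinuousMap.fst.comp (sliceRight (G := G)) = ContinuousMap.const G (1 : G) := by ext; rfl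
omit [IsTopologicalGroup G] in
/-- `pr₂ ∘ (x ↦ (1, x)) = 𝟙`. [folklore] -/
theorem snd_comp_sliceRight : ContinuousMap.snd.comp (sliceRight (G := G)) = ContinuousMap.id G := by ext; rfl
omit [Group G] [IsTopologicalGroup G] in
/-- `pr₁ ∘ Δ = 𝟙`. [folklore] -/
theorem fst_comp_diagMap : ContinuousMap.fst.comp (diagMap (G := G)) = ContinuousMap.id G := by ext; rfl
omit [Group G] [IsTopologicalGroup G] in
/-- `pr₂ ∘ Δ = 𝟙`. [folklore] -/
theorem snd_comp_diagMap : ContinuousMap.snd.comp (diagMap (G := G)) = ContinuousMap.id G := by ext; rfl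
/-- `μ ∘ (x ↦ (x, 1)) = 𝟙`. [folklore] -/
theorem mulMap_comp_sliceLeft : mulMap.comp (sliceLeft (G := G)) = ContinuousMap.id G := by
  ext x; change x * 1 = x; rw [mul_one]
/-- `μ ∘ (x ↦ (1, x)) = 𝟙`. [folklore] -/
theorem mulMap_comp_sliceRight : mulMap.comp (sliceRight (G := G)) = ContinuousMap.id G := by
  ext x; change 1 * x = x; rw [one_mul]
/-- `μ ∘ Δ = sq`. [cite: HatcherAT2002, §3.C p. 283] -/
theorem mulMap_comp_diagMap : mulMap.comp (diagMap (G := G)) = sqMap := by ext; rfl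

/-- `ψ = sq^*` on `Hᵏ(G; F)` as an endomorphism. [cite: HatcherAT2002, §3.C p. 283] -/
abbrev psi (k : ℕ) : Module.End F (singularCohomology F F G k) := (singularCohomology.map F F (sqMap (G := G)) k).hom

/-- `ψ` is multiplicative: `ψ(a ⌣ b) = ψ a ⌣ ψ b`. [cite: HatcherAT2002, Prop. 3.10] -/
theorem psi_cupProduct {i j k : ℕ} (h : i + j = k) (a : singularCohomology F F G i) (b : singularCohomology F F G j) :
    psi F k (cupProduct h a b) = cupProduct h (psi F i a) (psi F j b) :=
  cupProduct_map _ h a b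

/-- The **decomposable classes** of degree `k`: the span of the products `a ⌣ b` with
`deg a, deg b ≥ 1`, `deg a + deg b = k`. [cite: HatcherAT2002, §3.C p. 284] -/
def decomposables (k : ℕ) : Submodule F (singularCohomology F F G k) :=
  Submodule.span F {z | ∃ (i j : ℕ) (h : i + j = k), 1 ≤ i ∧ 1 ≤ j ∧
    ∃ (a : singularCohomology F F G i) (b : singularCohomology F F G j), z = cupProduct h a b}

omit [Group G] [IsTopologicalGroup G] in
/-- A product `a ⌣ b` with `deg a, deg b ≥ 1` is decomposable. [cite: HatcherAT2002, §3.C p. 284] -/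
theorem cupProduct_mem_decomposables {i j k : ℕ} (h : i + j = k) (hi : 1 ≤ i) (hj : 1 ≤ j)
    (a : singularCohomology F F G i) (b : singularCohomology F F G j) :
    cupProduct h a b ∈ decomposables F (G := G) k :=
  Submodule.subset_span ⟨i, j, h, hi, hj, a, b, rfl⟩

omit [Group G] [IsTopologicalGroup G] in
/-- There are no decomposable classes in degree `1`. [folklore] -/
theorem decomposables_one : decomposables F (G := G) 1 = ⊥ := by
  rw [decomposables, Submodule.span_eq_bot]
  rintro z ⟨i, j, h, hi, hj, -, -, -⟩
  omega

variable [CompactSpace G] [T2Space G] {n : ℕ} [ChartedSpace (EuclideanSpace ℝ (Fin n)) G]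

omit [Group G] [IsTopologicalGroup G] in
/-- `Hᵏ(G; F) = 0` for `k > n` (`G` a closed `n`-manifold; Hatcher Thm. 3.26(c) with universal
coefficients over a field). [cite: HatcherAT2002, §3.3 Thm. 3.26(c) and §3.1 Thm. 3.2] -/
theorem subsingleton_singularCohomology_of_dim_lt {k : ℕ} (hk : n < k) :
    Subsingleton (singularCohomology F F G k) := by
  haveI := ModuleCat.subsingleton_of_isZero (isZero_singularHomology_of_lt_holds F F G n hk)
  exact (kroneckerPairing_injective_of_field F G k).subsingleton

variable [PathConnectedSpace G]

include n in
/-- **`ψ x - 2x` is decomposable** for `x ∈ Hᵏ(G; F)`, `k ≥ 1`: by the spanning half of the Künneth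
theorem for the compact manifold `G × G` (Hatcher Thm. 3.16), `μ^* x = pr₁^* x + pr₂^* x + Σ pr₁^* aᵢ ⌣ pr₂^* bᵢ`
with `deg aᵢ, deg bᵢ ≥ 1` (the two extreme Künneth components are identified by restricting to the
slices `G × 1`, `1 × G`), and `ψ = Δ^* μ^*` for the diagonal `Δ`. [cite: HatcherAT2002, §3.C p. 283–284 and Thm. 3.16] -/
theorem psi_sub_two_smul_mem_decomposables {k : ℕ} (hk : k ≠ 0) (x : singularCohomology F F G k) :
    psi F k x - (2 : F) • x ∈ decomposables F (G := G) k := by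
  have hfin : ∀ k, Module.Finite F (singularCohomology F F G k) := fun k =>
    finite_singularCohomology_of_compact_chartedSpace F F (d := n) k
  have hspan := LerayHirsch.mem_span_cupProduct_fst_snd_of_finite F (M := G) (N := G) (EuclideanSpace ℝ (Fin n))
    hfin (fun k hk' => subsingleton_singularCohomology_of_dim_lt F (n := n) hk') k
    (singularCohomology.map F F (mulMap (G := G)) k x)
  -- the three restrictions of a Künneth generator
  have key : ∀ z ∈ Submodule.span F {v | ∃ (i j : ℕ) (h : i + j = k) (a : singularCohomology F F G i)
      (b : singularCohomology F F G j), v = cupProduct h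
        (singularCohomology.map F F (ContinuousMap.fst : C(G × G, G)) i a)
        (singularCohomology.map F F (ContinuousMap.snd : C(G × G, G)) j b)},
      singularCohomology.map F F diagMap k z - singularCohomology.map F F sliceLeft k z -
        singularCohomology.map F F sliceRight k z ∈ decomposables F (G := G) k := by
    intro z hz
    refine Submodule.span_induction ?_ ?_ ?_ ?_ hz
    · rintro _ ⟨i, j, h, a, b, rfl⟩
      simp only [cupProduct_map, singularCohomology.map_map, fst_comp_sliceLeft, snd_comp_sliceLeft,
        fst_comp_sliceRight, snd_comp_sliceRight, fst_comp_diagMap, snd_comp_diagMap, singularCohomology.map_id]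
      change cupProduct h a b - cupProduct h a (singularCohomology.map F F (ContinuousMap.const G (1 : G)) j b) -
        cupProduct h (singularCohomology.map F F (ContinuousMap.const G (1 : G)) i a) b ∈ decomposables F k
      rcases Nat.eq_zero_or_pos i with hi | hi
      · subst hi
        obtain rfl : j = k := by omega
        rw [singularCohomology.map_const_of_ne_zero F (1 : G) hk b, LinearMap.map_zero, sub_zero,
          singularCohomology.eq_smul_one F a]
        simp only [map_smul, LinearMap.smul_apply, singularCohomology.map_one, sub_self, Submodule.zero_mem]
      rcases Nat.eq_zero_or_pos j with hj | hj
      · subst hj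
        obtain rfl : i = k := by omega
        rw [singularCohomology.map_const_of_ne_zero F (1 : G) hk a, LinearMap.map_zero₂, sub_zero,
          singularCohomology.eq_smul_one F b]
        simp only [map_smul, singularCohomology.map_one, sub_self, Submodule.zero_mem]
      rw [singularCohomology.map_const_of_ne_zero F (1 : G) (by omega) b,
        singularCohomology.map_const_of_ne_zero F (1 : G) (by omega) a, LinearMap.map_zero, LinearMap.map_zero₂,
        sub_zero, sub_zero]
      exact cupProduct_mem_decomposables F h hi hj a b
    · simp only [map_zero, sub_zero]; exact Submodule.zero_mem _
    · intro z w _ _ hz hw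
      have e : singularCohomology.map F F diagMap k (z + w) - singularCohomology.map F F sliceLeft k (z + w) -
          singularCohomology.map F F sliceRight k (z + w) =
        (singularCohomology.map F F diagMap k z - singularCohomology.map F F sliceLeft k z -
          singularCohomology.map F F sliceRight k z) +
        (singularCohomology.map F F diagMap k w - singularCohomology.map F F sliceLeft k w -
          singularCohomology.map F F sliceRight k w) := by
        simp only [map_add]; abel
      rw [e]; exact Submodule.add_mem _ hz hw
    · intro c z _ hz
      have e : singularCohomology.map F F diagMap k (c • z) - singularCohomology.map F F sliceLeft k (c • z) -
          singularCohomology.map F F sliceRight k (c • z) =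
        c • (singularCohomology.map F F diagMap k z - singularCohomology.map F F sliceLeft k z -
          singularCohomology.map F F sliceRight k z) := by
        simp only [map_smul, smul_sub]
      rw [e]; exact Submodule.smul_mem _ c hz
  have h := key _ hspan
  rw [singularCohomology.map_map, singularCohomology.map_map, singularCohomology.map_map, mulMap_comp_diagMap,
    mulMap_comp_sliceLeft, mulMap_comp_sliceRight, singularCohomology.map_id] at h
  rw [two_smul, ← sub_sub]
  exact h

include n in
/-- **`ψ = 2` on `H¹(G; F)`** (degree-one classes are primitive). [cite: HatcherAT2002, §3.C Lemma 3C.3] -/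
theorem psi_one (v : singularCohomology F F G 1) : psi F 1 v = (2 : F) • v := by
  have h := psi_sub_two_smul_mem_decomposables F (n := n) one_ne_zero v
  rw [decomposables_one, Submodule.mem_bot, sub_eq_zero] at h
  exact h

include n in
/-- **`ψ = 2ᵈ` on the image of `⋀ᵈ H¹`**: `ψ (wedgeToCup ω) = 2ᵈ wedgeToCup ω`. [cite: HatcherAT2002, §3.C p. 286] -/
theorem psi_wedgeToCup [Invertible (2 : F)] (d : ℕ) (ω : ⋀[F]^d (singularCohomology F F G 1)) :
    psi F d (wedgeToCup F G d ω) = ((2 : F) ^ d) • wedgeToCup F G d ω := by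
  have e : psi F d ∘ₗ wedgeToCup F G d = ((2 : F) ^ d) • wedgeToCup F G d := by
    refine exteriorPower.linearMap_ext ?_
    ext v
    simp only [LinearMap.compAlternatingMap_apply, LinearMap.coe_comp, Function.comp_apply, wedgeToCup_ιMulti,
      LinearMap.smul_apply]
    rw [psi, map_cupPowOne]
    have hv : (fun i => singularCohomology.map F F (sqMap (G := G)) 1 (v i)) = fun i => (2 : F) • v i := by
      funext i; exact psi_one F (n := n) (v i)
    rw [hv, MultilinearMap.map_smul_univ, Finset.prod_const, Finset.card_univ, Fintype.card_fin]
  exact LinearMap.congr_fun e ω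

end Squaring

/-! ### Generalised eigenvectors under a compatible bilinear map -/

section Eigen

variable {K : Type*} [Field K] {U V W : Type*} [AddCommGroup U] [Module K U] [AddCommGroup V] [Module K V]
  [AddCommGroup W] [Module K W]

/-- If `h(β(u, v)) = β(f u, g v)` and `u`, `v` are killed by `(f - λ)ᵃ`, `(g - μ)ᵇ`, then `β(u, v)` is
killed by `(h - λμ)ᵃ⁺ᵇ` (from `(h - λμ) β(u, v) = β((f - λ)u, g v) + λ β(u, (g - μ)v)`). [folklore] -/
theorem pow_sub_smul_apply_bilin_eq_zero (β : U →ₗ[K] V →ₗ[K] W) (f : Module.End K U) (g : Module.End K V)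
    (h : Module.End K W) (hβ : ∀ u v, h (β u v) = β (f u) (g v)) (lam mu : K) :
    ∀ (a b : ℕ) (u : U) (v : V), ((f - lam • 1) ^ a) u = 0 → ((g - mu • 1) ^ b) v = 0 →
      ((h - (lam * mu) • 1) ^ (a + b)) (β u v) = 0 := by
  have hc : ∀ m : ℕ, Commute ((g - mu • 1) ^ m) g := fun m =>
    ((Commute.refl g).sub_left ((Commute.one_left g).smul_left mu)).pow_left m
  intro a
  induction a with
  | zero =>
    intro b u v hu _
    rw [pow_zero, Module.End.one_apply] at hu
    rw [hu, LinearMap.map_zero₂, map_zero]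
  | succ a iha =>
    intro b
    induction b with
    | zero =>
      intro u v _ hv
      rw [pow_zero, Module.End.one_apply] at hv
      rw [hv, map_zero, map_zero]
    | succ b ihb =>
      intro u v hu hv
      have step : (h - (lam * mu) • 1) (β u v) = β ((f - lam • 1) u) (g v) + lam • β u ((g - mu • 1) v) := by
        simp only [LinearMap.sub_apply, LinearMap.smul_apply, Module.End.one_apply, hβ, map_sub, map_smul,
          smul_sub, mul_smul]
        abel
      rw [show a + 1 + (b + 1) = (a + (b + 1)) + 1 by ring, pow_succ, Module.End.mul_apply, step, map_add, map_smul]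
      have h1 : ((h - (lam * mu) • 1) ^ (a + (b + 1))) (β ((f - lam • 1) u) (g v)) = 0 := by
        apply iha (b + 1)
        · rw [← Module.End.mul_apply, ← pow_succ, hu]
        · rw [← Module.End.mul_apply, hc, Module.End.mul_apply, hv, map_zero]
      have h2 : ((h - (lam * mu) • 1) ^ (a + (b + 1))) (β u ((g - mu • 1) v)) = 0 := by
        rw [show a + (b + 1) = a + 1 + b by ring]
        apply ihb u _ hu
        rw [← Module.End.mul_apply, ← pow_succ, hv]
      rw [h1, h2, smul_zero, add_zero]

/-- **Products of generalised eigenvectors are generalised eigenvectors for the product eigenvalue**,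
for a bilinear `β` intertwining `(f, g)` with `h`. [folklore] -/
theorem bilin_mem_maxGenEigenspace (β : U →ₗ[K] V →ₗ[K] W) (f : Module.End K U) (g : Module.End K V)
    (h : Module.End K W) (hβ : ∀ u v, h (β u v) = β (f u) (g v)) {lam mu : K} {u : U} {v : V}
    (hu : u ∈ f.maxGenEigenspace lam) (hv : v ∈ g.maxGenEigenspace mu) :
    β u v ∈ h.maxGenEigenspace (lam * mu) := by
  rw [Module.End.mem_maxGenEigenspace] at hu hv ⊢
  obtain ⟨a, ha⟩ := hu
  obtain ⟨b, hb⟩ := hv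
  exact ⟨a + b, pow_sub_smul_apply_bilin_eq_zero β f g h hβ lam mu a b u v ha hb⟩

/-- The same for sums of generalised eigenspaces over sets of eigenvalues `P`, `Q` with `P · Q ⊆ T`.
[folklore] -/
theorem bilin_mem_biSup_maxGenEigenspace (β : U →ₗ[K] V →ₗ[K] W) (f : Module.End K U) (g : Module.End K V)
    (h : Module.End K W) (hβ : ∀ u v, h (β u v) = β (f u) (g v)) {P Q T : Set K}
    (hPQ : ∀ lam ∈ P, ∀ mu ∈ Q, lam * mu ∈ T) {u : U} {v : V}
    (hu : u ∈ ⨆ lam ∈ P, f.maxGenEigenspace lam) (hv : v ∈ ⨆ mu ∈ Q, g.maxGenEigenspace mu) :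
    β u v ∈ ⨆ nu ∈ T, h.maxGenEigenspace nu := by
  classical
  suffices H : ∀ v ∈ ⨆ mu ∈ Q, g.maxGenEigenspace mu, β u v ∈ ⨆ nu ∈ T, h.maxGenEigenspace nu from H v hv
  refine Submodule.iSup_induction (p := fun lam => ⨆ (_ : lam ∈ P), f.maxGenEigenspace lam)
    (motive := fun u => ∀ v ∈ ⨆ mu ∈ Q, g.maxGenEigenspace mu, β u v ∈ ⨆ nu ∈ T, h.maxGenEigenspace nu) hu
    ?_ ?_ ?_
  · intro lam u hu v hv
    by_cases hlam : lam ∈ P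
    · rw [iSup_pos hlam] at hu
      refine Submodule.iSup_induction (p := fun mu => ⨆ (_ : mu ∈ Q), g.maxGenEigenspace mu)
        (motive := fun v => β u v ∈ ⨆ nu ∈ T, h.maxGenEigenspace nu) hv ?_ ?_ ?_
      · intro mu v hv
        by_cases hmu : mu ∈ Q
        · rw [iSup_pos hmu] at hv
          exact Submodule.mem_iSup_of_mem (lam * mu) (Submodule.mem_iSup_of_mem (hPQ lam hlam mu hmu)
            (bilin_mem_maxGenEigenspace β f g h hβ hu hv))
        · rw [iSup_neg hmu, Submodule.mem_bot] at hv
          rw [hv, map_zero]; exact Submodule.zero_mem _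
      · rw [map_zero]; exact Submodule.zero_mem _
      · intro x y hx hy; rw [map_add]; exact Submodule.add_mem _ hx hy
    · rw [iSup_neg hlam, Submodule.mem_bot] at hu
      rw [hu, LinearMap.map_zero₂]; exact Submodule.zero_mem _
  · intro v _; rw [LinearMap.map_zero₂]; exact Submodule.zero_mem _
  · intro x y hx hy v hv; rw [LinearMap.map_add₂]; exact Submodule.add_mem _ (hx v hv) (hy v hv)

/-- A generalised eigenspace of `f` is stable under `f`. [folklore] -/
theorem apply_mem_maxGenEigenspace_self (f : Module.End K V) {mu : K} {v : V} (hv : v ∈ f.maxGenEigenspace mu) :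
    f v ∈ f.maxGenEigenspace mu := by
  rw [Module.End.mem_maxGenEigenspace] at hv ⊢
  obtain ⟨a, ha⟩ := hv
  refine ⟨a, ?_⟩
  have hc : Commute ((f - mu • 1) ^ a) f := ((Commute.refl f).sub_left ((Commute.one_left f).smul_left mu)).pow_left a
  rw [← Module.End.mul_apply, hc, Module.End.mul_apply, ha, map_zero]

/-- A scalar operator `c • 𝟙` has no non-zero generalised eigenvector for `λ ≠ c`. [folklore] -/
theorem eq_of_mem_maxGenEigenspace_of_forall_eq_smul (f : Module.End K V) {c lam : K} (hf : ∀ v, f v = c • v)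
    {v : V} (hv : v ∈ f.maxGenEigenspace lam) (hv0 : v ≠ 0) : lam = c := by
  rw [Module.End.mem_maxGenEigenspace] at hv
  obtain ⟨a, ha⟩ := hv
  have e : f - lam • 1 = (c - lam) • 1 := by
    ext w; simp [hf, sub_smul]
  rw [e, smul_pow, one_pow, LinearMap.smul_apply, Module.End.one_apply, smul_eq_zero] at ha
  rcases ha with ha | ha
  · exact (sub_eq_zero.1 (eq_zero_of_pow_eq_zero ha)).symm
  · exact absurd ha hv0

end Eigen

/-! ### Generalised eigenvalues of `ψ` and surjectivity of `⋀ᵈ H¹ → Hᵈ` -/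

section Surjective

variable (F : Type) [Field F] {G : Type} [TopologicalSpace G] [Group G] [IsTopologicalGroup G]
  [CompactSpace G] [T2Space G] {n : ℕ} [ChartedSpace (EuclideanSpace ℝ (Fin n)) G] [PathConnectedSpace G]

/-- The admissible generalised eigenvalues `{2, 4, …, 2ᵏ}` of `ψ` on `Hᵏ`. [cite: HatcherAT2002, §3.C p. 286] -/
def powTwoSet (k : ℕ) : Set F := {mu | ∃ j : ℕ, 1 ≤ j ∧ j ≤ k ∧ mu = (2 : F) ^ j}

omit [TopologicalSpace G] [Group G] [IsTopologicalGroup G] [CompactSpace G] [T2Space G]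
  [ChartedSpace (EuclideanSpace ℝ (Fin n)) G] [PathConnectedSpace G] in
/-- `2 ∈ {2, …, 2ᵏ}` for `k ≥ 1`. [folklore] -/
theorem two_mem_powTwoSet {k : ℕ} (hk : 1 ≤ k) : (2 : F) ∈ powTwoSet F k := ⟨1, le_rfl, hk, (pow_one _).symm⟩

omit [TopologicalSpace G] [Group G] [IsTopologicalGroup G] [CompactSpace G] [T2Space G]
  [ChartedSpace (EuclideanSpace ℝ (Fin n)) G] [PathConnectedSpace G] in
/-- `{2, …, 2ⁱ} · {2, …, 2ʲ} ⊆ {2, …, 2ⁱ⁺ʲ}`. [folklore] -/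
theorem mul_mem_powTwoSet {i j k : ℕ} (h : i + j = k) {lam mu : F} (hl : lam ∈ powTwoSet F i) (hm : mu ∈ powTwoSet F j) :
    lam * mu ∈ powTwoSet F k := by
  obtain ⟨a, ha1, ha2, rfl⟩ := hl
  obtain ⟨b, hb1, hb2, rfl⟩ := hm
  exact ⟨a + b, by omega, by omega, (pow_add _ _ _).symm⟩

include n in
/-- **Every generalised eigenvalue of `ψ` on `Hᵏ(G; F)`, `k ≥ 1`, is one of `2, 4, …, 2ᵏ`**
(`F` algebraically closed of characteristic `0`): by induction on `k`, using that `ψ x - 2x` is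
decomposable, that products of generalised eigenvectors of degrees `i, j < k` have eigenvalues
`2ⁱ'·2ʲ'`, and the independence of generalised eigenspaces. [cite: HatcherAT2002, §3.C p. 286] -/
theorem iSup_maxGenEigenspace_psi_eq_top [IsAlgClosed F] [CharZero F] (k : ℕ) (hk : 1 ≤ k) :
    ⨆ mu ∈ powTwoSet F k, (psi F (G := G) k).maxGenEigenspace mu = ⊤ := by
  induction k using Nat.strong_induction_on with
  | _ k ih =>
  haveI : ∀ m, FiniteDimensional F (singularCohomology F F G m) := fun m =>
    finite_singularCohomology_of_compact_chartedSpace F F (d := n) m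
  have hind := Module.End.independent_maxGenEigenspace (psi F (G := G) k)
  -- the decomposables lie in the admissible part
  have hdec : decomposables F (G := G) k ≤ ⨆ mu ∈ powTwoSet F k, (psi F (G := G) k).maxGenEigenspace mu := by
    rw [decomposables, Submodule.span_le]
    rintro _ ⟨i, j, h, hi, hj, a, b, rfl⟩
    have hik : i < k := by omega
    have hjk : j < k := by omega
    have ha : a ∈ ⨆ mu ∈ powTwoSet F i, (psi F (G := G) i).maxGenEigenspace mu := by
      rw [ih i hik hi]; exact Submodule.mem_top
    have hb : b ∈ ⨆ mu ∈ powTwoSet F j, (psi F (G := G) j).maxGenEigenspace mu := by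
      rw [ih j hjk hj]; exact Submodule.mem_top
    exact bilin_mem_biSup_maxGenEigenspace (cupProduct h) (psi F i) (psi F j) (psi F k) (psi_cupProduct F h)
      (fun lam hl mu hm => mul_mem_powTwoSet F h hl hm) ha hb
  -- every other generalised eigenspace vanishes
  have hbot : ∀ mu ∉ powTwoSet F k, (psi F (G := G) k).maxGenEigenspace mu = ⊥ := by
    intro mu hmu
    rw [Submodule.eq_bot_iff]
    intro x hx
    have hdx : psi F k x - (2 : F) • x ∈ (psi F (G := G) k).maxGenEigenspace mu :=
      Submodule.sub_mem _ (apply_mem_maxGenEigenspace_self _ hx) (Submodule.smul_mem _ _ hx)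
    have hdx' := hdec (psi_sub_two_smul_mem_decomposables F (n := n) (by omega) x)
    have hzero : psi F k x - (2 : F) • x = 0 :=
      (Submodule.disjoint_def.1 (hind.disjoint_biSup hmu)) _ hdx hdx'
    have hx2 : x ∈ (psi F (G := G) k).maxGenEigenspace 2 := by
      rw [Module.End.mem_maxGenEigenspace]
      refine ⟨1, ?_⟩
      rw [pow_one, LinearMap.sub_apply, LinearMap.smul_apply, Module.End.one_apply]
      exact hzero
    have hne : mu ≠ 2 := fun e => hmu (e ▸ two_mem_powTwoSet F hk)
    exact (Submodule.disjoint_def.1 (hind.pairwiseDisjoint hne)) _ hx hx2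
  rw [eq_top_iff, ← Module.End.iSup_maxGenEigenspace_eq_top (psi F (G := G) k),
    iSup_split _ (fun mu => mu ∈ powTwoSet F k)]
  refine sup_le le_rfl ?_
  refine iSup₂_le fun mu hmu => ?_
  rw [hbot mu hmu]
  exact bot_le

/-! ### The subalgebra generated by `H¹` is closed under products -/

omit [Group G] [IsTopologicalGroup G] [CompactSpace G] [T2Space G] [ChartedSpace (EuclideanSpace ℝ (Fin n)) G]
  [PathConnectedSpace G] in
/-- `v ⌣ S^m ⊆ S^{m+1}` for the image `S` of `wedgeToCup`. [folklore] -/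
theorem cupProduct_mem_range_wedgeToCup_succ [Invertible (2 : F)] {m : ℕ} (v : singularCohomology F F G 1)
    {z : singularCohomology F F G m} (hz : z ∈ LinearMap.range (wedgeToCup F G m)) :
    cupProduct (Nat.add_comm 1 m) v z ∈ LinearMap.range (wedgeToCup F G (m + 1)) := by
  rw [range_wedgeToCup] at hz ⊢
  refine Submodule.span_induction ?_ ?_ ?_ ?_ hz
  · rintro _ ⟨w, rfl⟩
    rw [cupProduct_cupPowOne]
    exact Submodule.subset_span ⟨Fin.cons v w, rfl⟩
  · rw [LinearMap.map_zero]; exact Submodule.zero_mem _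
  · intro x y _ _ hx hy; rw [map_add]; exact Submodule.add_mem _ hx hy
  · intro c x _ hx; rw [map_smul]; exact Submodule.smul_mem _ c hx

omit [Group G] [IsTopologicalGroup G] [CompactSpace G] [T2Space G] [ChartedSpace (EuclideanSpace ℝ (Fin n)) G] in
/-- **`Sⁱ ⌣ Sʲ ⊆ Sⁱ⁺ʲ`** for the image `S` of `wedgeToCup` (products of products of degree-one classes
are products of degree-one classes). [folklore] -/
theorem cupProduct_mem_range_wedgeToCup [Invertible (2 : F)] {i j k : ℕ} (h : i + j = k)
    {a : singularCohomology F F G i} {b : singularCohomology F F G j}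
    (ha : a ∈ LinearMap.range (wedgeToCup F G i)) (hb : b ∈ LinearMap.range (wedgeToCup F G j)) :
    cupProduct h a b ∈ LinearMap.range (wedgeToCup F G k) := by
  induction i generalizing k with
  | zero =>
    obtain rfl : j = k := by omega
    rw [singularCohomology.eq_smul_one F a, LinearMap.map_smul₂, one_cupProduct']
    exact Submodule.smul_mem _ _ hb
  | succ i ih =>
    obtain rfl : k = i + j + 1 := by omega
    rw [range_wedgeToCup] at ha
    refine Submodule.span_induction ?_ ?_ ?_ ?_ ha
    · rintro _ ⟨u, rfl⟩
      rw [cupPowOne_succ, cupProduct_assoc (Nat.add_comm 1 i) rfl h (by omega)]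
      refine cupProduct_mem_range_wedgeToCup_succ F (u 0) (ih rfl ?_)
      rw [range_wedgeToCup]
      exact Submodule.subset_span ⟨Fin.tail u, rfl⟩
    · rw [LinearMap.map_zero₂]; exact Submodule.zero_mem _
    · intro x y _ _ hx hy; rw [LinearMap.map_add₂]; exact Submodule.add_mem _ hx hy
    · intro c x _ hx; rw [LinearMap.map_smul₂]; exact Submodule.smul_mem _ c hx

omit [TopologicalSpace G] [Group G] [IsTopologicalGroup G] [CompactSpace G] [T2Space G]
  [ChartedSpace (EuclideanSpace ℝ (Fin n)) G] [PathConnectedSpace G] in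
/-- `2ᵃ = 2ᵇ` in a field of characteristic zero forces `a = b`. [folklore] -/
theorem two_pow_injective [CharZero F] {a b : ℕ} (h : (2 : F) ^ a = (2 : F) ^ b) : a = b := by
  have h' : ((2 ^ a : ℕ) : F) = ((2 ^ b : ℕ) : F) := by push_cast; exact h
  exact Nat.pow_right_injective le_rfl (Nat.cast_injective h')

/-! ### Surjectivity -/

include n in
/-- **Surjectivity of `⋀ᵏ H¹(G; F) → Hᵏ(G; F)` for a compact connected group `n`-manifold with
`b₁ ≥ n`** (`F` algebraically closed of characteristic `0`): see the module docstring — minimal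
bad degree `d`, an eigenvector `x ∉ S^d` of `ψ` for the eigenvalue `2`, a Poincaré-dual partner `y`,
and the eigenvalue `2 · 2ʲ ≠ 2ⁿ` of `x ⌣ y` in the line `Hⁿ(G) = F · (v₁ ⌣ ⋯ ⌣ vₙ)`.
[cite: Hopf1941, Satz I] [cite: HatcherAT2002, §3.C Thm. 3C.4 and §3.3 Prop. 3.38] -/
theorem range_wedgeToCup_eq_top_of_group [IsAlgClosed F] [CharZero F]
    (hn : n ≤ Module.finrank F (singularCohomology F F G 1)) (k : ℕ) :
    LinearMap.range (wedgeToCup F G k) = ⊤ := by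
  classical
  have hG : ∀ m, Module.Finite F (singularHomology F F G m) := fun m =>
    finite_singularHomology_of_compactSpace_holds F G n m
  haveI hfin : ∀ m, FiniteDimensional F (singularCohomology F F G m) := fun m =>
    finite_singularCohomology_of_compact_chartedSpace F F (d := n) m
  have hinj : ∀ d, Function.Injective (wedgeToCup F G d) := wedgeToCup_injective_of_group F hG
  -- vanishing above `n` and `b₁ = n`
  have hvan : ∀ m, n < m → ∀ z : singularCohomology F F G m, z = 0 := fun m hm z => by
    haveI := subsingleton_singularCohomology_of_dim_lt F (G := G) (n := n) hm
    exact Subsingleton.elim _ _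
  have hb1 : Module.finrank F (singularCohomology F F G 1) = n := by
    refine le_antisymm ?_ hn
    by_contra hlt
    push Not at hlt
    have h1 : Module.finrank F (⋀[F]^(Module.finrank F (singularCohomology F F G 1)) (singularCohomology F F G 1)) = 1 := by
      rw [exteriorPower.finrank_eq, Nat.choose_self]
    haveI : Subsingleton (⋀[F]^(Module.finrank F (singularCohomology F F G 1)) (singularCohomology F F G 1)) :=
      ⟨fun x y => hinj _ (by rw [hvan _ hlt (wedgeToCup F G _ x), hvan _ hlt (wedgeToCup F G _ y)])⟩
    rw [Module.finrank_zero_of_subsingleton] at h1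
    exact zero_ne_one h1
  -- orientation and the top cohomology `Hⁿ(G) ≅ F`
  obtain ⟨μZ⟩ := isOrientableOver_int_of_isTopologicalGroup (n := n) G
  let μ : HomologicalOrientation F G n := μZ.toCoeff F
  obtain ⟨etop⟩ := nonempty_singularCohomology_top_equiv_holds F G n ⟨μ⟩
  have htop1 : Module.finrank F (singularCohomology F F G n) = 1 := by
    rw [etop.finrank_eq, Module.finrank_self]
  -- `ψ = 2ⁿ` on the line `Hⁿ(G)`, spanned by a product of `n` degree-one classes
  have hPex : ∃ P : singularCohomology F F G n, P ≠ 0 ∧ psi F n P = (2 : F) ^ n • P := by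
    have hne : Module.finrank F (⋀[F]^n (singularCohomology F F G 1)) = 1 := by
      rw [exteriorPower.finrank_eq, hb1, Nat.choose_self]
    obtain ⟨ω, hω⟩ : ∃ ω : ⋀[F]^n (singularCohomology F F G 1), ω ≠ 0 := by
      by_contra hall
      push Not at hall
      haveI : Subsingleton (⋀[F]^n (singularCohomology F F G 1)) := ⟨fun x y => by rw [hall x, hall y]⟩
      rw [Module.finrank_zero_of_subsingleton] at hne
      exact zero_ne_one hne
    exact ⟨wedgeToCup F G n ω, fun h0 => hω (hinj n (by rw [h0, map_zero])), psi_wedgeToCup F (n := n) n ω⟩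
  obtain ⟨P, hP0, hPpsi⟩ := hPex
  have htop : ∀ z : singularCohomology F F G n, psi F n z = (2 : F) ^ n • z := by
    intro z
    obtain ⟨c, rfl⟩ := (finrank_eq_one_iff_of_nonzero' P hP0).1 htop1 z
    rw [map_smul, hPpsi, smul_comm]
  -- suppose the comparison map is not onto in some degree, and take the least such degree `d`
  by_contra hk
  have hex : ∃ d, LinearMap.range (wedgeToCup F G d) ≠ ⊤ := ⟨k, hk⟩
  obtain ⟨d, hd, hmin⟩ : ∃ d, LinearMap.range (wedgeToCup F G d) ≠ ⊤ ∧
      ∀ e < d, LinearMap.range (wedgeToCup F G e) = ⊤ :=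
    ⟨Nat.find hex, Nat.find_spec hex, fun e he => not_not.1 (Nat.find_min hex he)⟩
  have hd0 : d ≠ 0 := by
    rintro rfl
    apply hd
    rw [eq_top_iff]
    rintro a -
    rw [singularCohomology.eq_smul_one F a, range_wedgeToCup]
    exact Submodule.smul_mem _ _ (Submodule.subset_span ⟨Fin.elim0, rfl⟩)
  have hd1 : d ≠ 1 := by
    rintro rfl
    apply hd
    rw [eq_top_iff]
    rintro v -
    exact ⟨exteriorPower.ιMulti F 1 (fun _ => v), by rw [wedgeToCup_ιMulti, cupPowOne_one]⟩
  have hdn : d ≤ n := by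
    by_contra hlt
    push Not at hlt
    apply hd
    rw [eq_top_iff]
    rintro z -
    rw [hvan d hlt z]
    exact Submodule.zero_mem _
  -- in degree `d` the decomposables lie in `S^d`
  have hdecS : decomposables F (G := G) d ≤ LinearMap.range (wedgeToCup F G d) := by
    rw [decomposables, Submodule.span_le]
    rintro _ ⟨i, j, h, hi, hj, a, b, rfl⟩
    refine cupProduct_mem_range_wedgeToCup F h ?_ ?_
    · rw [hmin i (by omega)]; exact Submodule.mem_top
    · rw [hmin j (by omega)]; exact Submodule.mem_top
  -- an eigenvector of `ψ` for the eigenvalue `2` outside `S^d`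
  obtain ⟨z, hz⟩ : ∃ z, z ∉ LinearMap.range (wedgeToCup F G d) := by
    by_contra hall
    push Not at hall
    exact hd (eq_top_iff.2 fun z _ => hall z)
  have hw : psi F d z - (2 : F) • z ∈ LinearMap.range (wedgeToCup F G d) :=
    hdecS (psi_sub_two_smul_mem_decomposables F (n := n) hd0 z)
  have hpsiS : ∀ w ∈ LinearMap.range (wedgeToCup F G d), psi F d w = (2 : F) ^ d • w := by
    rintro _ ⟨ω, rfl⟩
    exact psi_wedgeToCup F (n := n) d ω
  set x := psi F d z - (2 : F) ^ d • z with hxdef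
  have hx2 : psi F d x = (2 : F) • x := by
    have e : psi F d x - (2 : F) • x =
        psi F d (psi F d z - (2 : F) • z) - (2 : F) ^ d • (psi F d z - (2 : F) • z) := by
      simp only [hxdef, map_sub, map_smul, smul_sub, smul_smul, mul_comm ((2 : F) ^ d) 2]
      abel
    rw [hpsiS _ hw, sub_self] at e
    exact sub_eq_zero.1 e
  have hxS : x ∉ LinearMap.range (wedgeToCup F G d) := by
    intro hxS'
    apply hz
    have e : ((2 : F) - (2 : F) ^ d) • z = x - (psi F d z - (2 : F) • z) := by
      rw [hxdef, sub_smul]; abel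
    have hmem : ((2 : F) - (2 : F) ^ d) • z ∈ LinearMap.range (wedgeToCup F G d) := by
      rw [e]; exact Submodule.sub_mem _ hxS' hw
    have hne : (2 : F) - (2 : F) ^ d ≠ 0 := by
      rw [sub_ne_zero]
      intro h
      have h' := two_pow_injective F (a := 1) (b := d) (by rw [pow_one]; exact h)
      exact hd1 h'.symm
    rwa [Submodule.smul_mem_iff _ hne] at hmem
  have hx0 : x ≠ 0 := fun h => hxS (h ▸ Submodule.zero_mem _)
  have hxgen : x ∈ (psi F (G := G) d).maxGenEigenspace 2 := by
    rw [Module.End.mem_maxGenEigenspace]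
    refine ⟨1, ?_⟩
    rw [pow_one, LinearMap.sub_apply, LinearMap.smul_apply, Module.End.one_apply, hx2, sub_self]
  -- a Poincaré-dual partner `y` with `x ⌣ y ≠ 0`
  obtain ⟨e, hde⟩ : ∃ e, d + e = n := ⟨n - d, by omega⟩
  have hPD : (cupPairing μ hde).IsPerfPair := isPerfPair_cupPairing_of_field_holds
  obtain ⟨y, hy⟩ : ∃ y : singularCohomology F F G e, cupProduct hde x y ≠ 0 := by
    by_contra hall
    push Not at hall
    apply hx0
    apply hPD.bijective_left.1
    rw [map_zero]
    refine LinearMap.ext fun y' => ?_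
    rw [cupPairing_apply, hall y', map_zero, LinearMap.zero_apply, LinearMap.zero_apply]
  rcases Nat.eq_zero_or_pos e with he | he
  · -- `e = 0`: `x` lives in the top degree, where `ψ = 2ⁿ ≠ 2`
    subst he
    obtain rfl : n = d := by omega
    have e1 := htop x
    rw [hx2] at e1
    have e2 : ((2 : F) ^ n - 2) • x = 0 := by rw [sub_smul, ← e1, sub_self]
    rcases smul_eq_zero.1 e2 with h | h
    · have h' := two_pow_injective F (a := n) (b := 1) (by rw [pow_one]; exact sub_eq_zero.1 h)
      exact hd1 h'
    · exact hx0 h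
  · -- `e ≥ 1`: split `y` into generalised eigenvectors of `ψ`
    have hysplit : y ∈ ⨆ mu ∈ powTwoSet F e, (psi F (G := G) e).maxGenEigenspace mu := by
      rw [iSup_maxGenEigenspace_psi_eq_top F (n := n) e he]
      exact Submodule.mem_top
    obtain ⟨mu, hmu, y', hy', hprod⟩ :
        ∃ mu ∈ powTwoSet F e, ∃ y' ∈ (psi F (G := G) e).maxGenEigenspace mu, cupProduct hde x y' ≠ 0 := by
      by_contra hall
      push Not at hall
      apply hy
      have hker : (⨆ mu ∈ powTwoSet F e, (psi F (G := G) e).maxGenEigenspace mu) ≤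
          LinearMap.ker (cupProduct hde x) :=
        iSup₂_le fun mu hmu y' hy' => hall mu hmu y' hy'
      exact hker hysplit
    have hmem : cupProduct hde x y' ∈ (psi F (G := G) n).maxGenEigenspace (2 * mu) :=
      bilin_mem_maxGenEigenspace (cupProduct hde) (psi F d) (psi F e) (psi F n) (psi_cupProduct F hde) hxgen hy'
    have heq : 2 * mu = (2 : F) ^ n := eq_of_mem_maxGenEigenspace_of_forall_eq_smul (psi F n) htop hmem hprod
    obtain ⟨j, hj1, hj2, rfl⟩ := hmu
    rw [← pow_succ'] at heq
    have := two_pow_injective F heq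
    omega

include n in
/-- **`H•(G; F) = ⋀• H¹(G; F)` for a compact connected group `n`-manifold with `b₁ ≥ n`** (`F`
algebraically closed of characteristic `0`; Hopf 1941, Satz I — in particular for the complex points
of a complex abelian variety, Mumford §1 (4), Lange–Birkenhake Exercise 1.1.6 (7)): every comparison
map `⋀ᵏ H¹(G; F) → Hᵏ(G; F)` is bijective. [cite: Hopf1941, Satz I] [cite: LangeBirkenhake1992, Exercise 1.1.6 (7)] -/
theorem hasExteriorCohomologyH1_of_group [IsAlgClosed F] [CharZero F]
    (hn : n ≤ Module.finrank F (singularCohomology F F G 1)) : HasExteriorCohomologyH1 F G := fun k =>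
  ⟨wedgeToCup_injective_of_group F (fun m => finite_singularHomology_of_compactSpace_holds F G n m) k,
    LinearMap.range_eq_top.1 (range_wedgeToCup_eq_top_of_group F (n := n) hn k)⟩

include n in
/-- **`b₁ = n`** for a compact connected group `n`-manifold with `b₁ ≥ n` (then `⋀ᵇ¹ H¹ ≠ 0` injects
into `Hᵇ¹`, which vanishes above the dimension). [cite: Hopf1941, Satz I] [cite: MumfordAV1970, §1 (3)] -/
theorem finrank_one_eq_of_group [IsAlgClosed F] [CharZero F]
    (hn : n ≤ Module.finrank F (singularCohomology F F G 1)) :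
    Module.finrank F (singularCohomology F F G 1) = n := by
  haveI : FiniteDimensional F (singularCohomology F F G 1) :=
    finite_singularCohomology_of_compact_chartedSpace F F (d := n) 1
  have h := hasExteriorCohomologyH1_of_group F (n := n) hn
  refine le_antisymm ?_ hn
  by_contra hlt
  push Not at hlt
  haveI := subsingleton_singularCohomology_of_dim_lt F (G := G) (n := n) hlt
  have h1 := h.finrank_eq (Module.finrank F (singularCohomology F F G 1))
  rw [Nat.choose_self, Module.finrank_zero_of_subsingleton] at h1
  exact zero_ne_one h1

end Surjective

end Literature.AlgebraicTopology.SingularHomology
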